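import Literature.MathematicalPhysics.QuantumFieldTheory.BalabanImbrieJaffe1984to88.BIJ88RegionCornerReduction309
import Literature.MathematicalPhysics.QuantumFieldTheory.BalabanImbrieJaffe1984to88.BIJ88TripleActivity309

/-!
# `BalabanImbrieJaffe1984to88.BIJ88ActInLastCube309` — T. Bałaban, J. Imbrie, A. Jaffe, *Effective action and cluster properties of the abelian
Higgs model*, Commun. Math. Phys. **114** (1988) 257–315 [BalabanImbrieJaffe1988], Sect. 5.14 (5.14.3)–(5.14.4) p. 309 [PDF 53] with Sect. 5.13
(5.13.3) p. 305–306 [PDF 49–50]: **THE LOCATED ACTIVITY `g₃(H, X″)` OF A MULTI-CUBE POLYMER COSTS ONE `s`-DERIVATIVE** — the capstone of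
p36 gen 18's successor infrastructure (`BIJ88CornerSumLastCube309`, `BIJ88RegionLawUniv309`, `BIJ88RegionCornerReduction309`): for `|X″| ≥ 2`
the prime-dropped located activity of the (5.14.3) expansion (`BIJ88W6PrimeVsupp.actIn` = p25's `g₁` of the corner expectations `z X″ ·` of the
p. 308 derivative observables `fD`) satisfies `|actIn … H X″| ≤ 2^{|X″|−1} · B` as soon as ONE first `s`-derivative of p13's engine —
`∂{n}⟨Π_{□_i⊂X″} fD_i⟩(s)` (`BIJ88CumulantAllOrders5133.dexp … {n}`, a sum of trains from the bonds of `□_n` by `BIJ88WalkFormOrderOne5133.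
dexp_singleton_walk`) — is bounded by `B` uniformly on the cube `[0,1]^I`, for some cube `n` of `X″`.  This is the order-ONE entrance to the
re-scoped flip item of row C2.Eq5.14.3-5.14.4 (r16 ROWS-C2-part2 v2.253: (5.14.4) on `|X_β| ≥ 3` for coupled `Δ` with (i) a decay letter on
`C_s` and (ii) the located V-surplus clause): for an END-decorated chain the far end `n` supplies the whole decay through (i).

statement-level skeleton of published theorems with citation tags; proofs where landed; nothing here is a claim about the Yang–Mills mass gap

PDF held: `paper:balaban1988-cmp114-bij-abelian-higgs-effective-action` (journal page = PDF page + 256); p. 309 (p0053.txt L14–16), verbatim: *"We use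
X_β∖H_β to denote the set of cubes with no (d/dt)_{γ_j} factors, j ∈ H_β. The proof of this estimate is similar to the one for g₂. We mention only
the new features."*; p. 307, verbatim: *"Each time some □_i's are joined, we have s-derivatives, which produce functional derivatives, chains
of covariances C_ω(α), and factors ℱ = O(e^{−cr(e_k)})."*

WHAT IS PROVED (unit `lit-balaban-p36`, generation 18 of the Phase-2 proof seat p36; SKELETON rows C2.Eq5.14.3-5.14.4 / C2.Eq5.13.3-5.13.4 of
`HOME/lit-balaban-r16/ROWS-C2-part2.md`, owner r16 — an abstract bound (the derivative bound `B` and the cube-locality of the `fD` are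
hypotheses), no letters, no head change).
* **`abs_actIn_le_of_dexp_bound`** — the displayed bound.
HONEST SCOPE: 0 `sorry`, 0 definitions, 0 `Prop` facts (D-0026); imports `BIJ88RegionCornerReduction309` and `BIJ88TripleActivity309` (p36 g18);
modifies nothing.  NOT summit progress; NOT continuum; NOT Clay.  Cell `lit-balaban` Phase 2, seat p36 gen 18 (owner r16, referee ref-5).
-/

noncomputable section

open Finset MeasureTheory Matrix Function Filter
open Literature.MathematicalPhysics.QuantumFieldTheory.BalabanImbrieJaffe1984to88
open BIJ88Sect5Statements (CutoffProfile)
open BIJ88DirichletForms305 (interpForm)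
open BIJ88Clusters5134 (cornerSum act)
open BIJ88PolymerRep5134 (g1_of_two_le IsConn corner)
open BIJ88PolymerRep5134Gauss (zG)
open BIJ88Expansion5143 (g3 prime prime_of_not)
open BIJ88Expansion5143Gauss (fD)
open BIJ88SlotMomentsGauss308 (uD)
open BIJ88Eq5145CornerModel (slotB slotY)
open BIJ88Eq5145CornerUrsell (cubeIn)
open BIJ88W6PrimeVsupp (actIn)
open BIJ88CumulantAllOrders5133 (dexp)
open BIJ88RegionCornerReduction309 (abs_cornerSum_zG_le)

namespace Literature.MathematicalPhysics.QuantumFieldTheory.BalabanImbrieJaffe1984to88.BIJ88ActInLastCube309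

variable {α I : Type} [Fintype α] [DecidableEq α] [Fintype I] [DecidableEq I]
  (blk : α → I) (Δ : Matrix α α ℝ) (ℱ : α → ℝ)
variable (adj : I → I → Prop) [DecidableRel adj]
variable (χ : CutoffProfile) {ι υ : Type*} [DecidableEq ι] [DecidableEq υ]
variable (p ek : ℝ) (B : Finset ι) (Φ : ι → (α → ℝ) → ℝ) (c : ι → ℝ) (Ys : Finset υ) (V : υ → (α → ℝ) → ℝ)
variable (cube : ↥B ⊕ ↥Ys → I)

/-- **`|g₃(H, X″)| ≤ 2^{|X″|−1}·sup_{s∈[0,1]^I}|∂{n}⟨Π_{□_i⊂X″} fD_i⟩(s)|`** for `|X″| ≥ 2`, `n ∈ X″`: the prime-dropped located activity of the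
region `X` at `(Λ, t, γ)` (`actIn`) is, on a connected `X″`, the corner sum over `X″` of the corner expectations `z X″ ·` of the cube factors
`fD` for the precision `Δ_{1_Λ}` (`BIJ88TripleActivity309.actIn_eq_cornerSum` / p25 `g1_of_two_le`), hence bounded by the last-cube bound of
`BIJ88RegionCornerReduction309.abs_cornerSum_zG_le`; off connected `X″` it vanishes.  Hypotheses: `Δ_{1_Λ} ≻ 0` with form bounds (p13's engine),
cube-locality of the `fD_i` (`BIJ88Expansion5143Gauss.fD_local` from the located slot data), measurability and a sup bound of their product, and the
derivative bound `B`. [cite: BalabanImbrieJaffe1988, (5.14.3)–(5.14.4) p.309; (5.13.3) p.305] -/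
theorem abs_actIn_le_of_dexp_bound (Λ X : Finset I) (t : ℝ) {L : Type*} [DecidableEq L]
    (γ : L → ↥(slotB B Ys cube X) ⊕ ↥(slotY B Ys cube X)) (H : Finset L) {X'' : Finset I} (h2 : 2 ≤ X''.card)
    (hΔ : (interpForm blk Δ (corner ℝ Λ)).PosDef) {cl Cu : ℝ} (hcl : 0 < cl)
    (hclΔ : ∀ v, cl * (v ⬝ᵥ v) ≤ v ⬝ᵥ (interpForm blk Δ (corner ℝ Λ) *ᵥ v))
    (hCuΔ : ∀ v, v ⬝ᵥ (interpForm blk Δ (corner ℝ Λ) *ᵥ v) ≤ Cu * (v ⬝ᵥ v))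
    (hf : ∀ i (φ ψ : α → ℝ), (∀ x, blk x = i → φ x = ψ x) →
      fD (uD χ p ek (slotB B Ys cube X) (fun b : ↥B => Φ b) (fun b : ↥B => c b) (slotY B Ys cube X) (fun Y : ↥Ys => V Y) t)
        (cubeIn cube X) γ H i φ =
      fD (uD χ p ek (slotB B Ys cube X) (fun b : ↥B => Φ b) (fun b : ↥B => c b) (slotY B Ys cube X) (fun Y : ↥Ys => V Y) t)
        (cubeIn cube X) γ H i ψ)
    (hfm : AEStronglyMeasurable (fun ψ : α → ℝ => ∏ i ∈ X'',
      fD (uD χ p ek (slotB B Ys cube X) (fun b : ↥B => Φ b) (fun b : ↥B => c b) (slotY B Ys cube X) (fun Y : ↥Ys => V Y) t)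
        (cubeIn cube X) γ H i ψ) volume)
    {K₀ : ℝ} (hK : ∀ ψ : α → ℝ, ‖∏ i ∈ X'',
      fD (uD χ p ek (slotB B Ys cube X) (fun b : ↥B => Φ b) (fun b : ↥B => c b) (slotY B Ys cube X) (fun Y : ↥Ys => V Y) t)
        (cubeIn cube X) γ H i ψ‖ ≤ K₀)
    {n : I} (hn : n ∈ X'') {Bd : ℝ}
    (hB : ∀ s : I → ℝ, (∀ l, 0 ≤ s l ∧ s l ≤ 1) →
      |dexp blk (interpForm blk Δ (corner ℝ Λ)) ℱ (fun ψ => ∏ i ∈ X'',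
        fD (uD χ p ek (slotB B Ys cube X) (fun b : ↥B => Φ b) (fun b : ↥B => c b) (slotY B Ys cube X) (fun Y : ↥Ys => V Y) t)
          (cubeIn cube X) γ H i ψ) {n} s| ≤ Bd) :
    |actIn blk Δ ℱ adj χ p ek B Φ c Ys V cube Λ X t γ H X''| ≤ 2 ^ (X''.card - 1) * Bd := by
  have hBd : 0 ≤ Bd := le_trans (abs_nonneg _) (hB (fun _ => 0) fun _ => ⟨le_rfl, zero_le_one⟩)
  simp only [actIn]
  rw [prime_of_not _ (fun h => by omega), g3, g1_of_two_le adj _ h2]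
  split_ifs with hconn
  · rw [act]
    exact abs_cornerSum_zG_le blk ℱ hΔ hcl hclΔ hCuΔ hf hfm hK hn hB
  · rw [abs_zero]; positivity

end Literature.MathematicalPhysics.QuantumFieldTheory.BalabanImbrieJaffe1984to88.BIJ88ActInLastCube309

end
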